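import Mathlib

/-!
# SoloBlind — seed certificate algebra for the discrete-direct engine (regime (II) window)

Four elementary facts used by the certified evaluation of recessive solutions of a three-term recurrence
`u k = β (k+1) * u (k+1) - u (k+2)` from a finite seed (ENGINE D of the solo-blind notes, PLAN §118):

* `pringsheim_backward` — the finite Śleszyński–Pringsheim step: if `‖β (k+1)‖ ≥ 2` for `M ≤ k < N` and the
  sequence is seeded by `u (N+1) = 0`, `u N ≠ 0`, then `u k ≠ 0` and `‖u (k+1)‖ ≤ ‖u k‖` for all `M ≤ k ≤ N`
  (the backward ratios stay in the closed unit disc);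
* `seed_ratio_identity` / `seed_ratio_bound` — for `u = a + ρ b` with `‖ρ‖ ≤ 1` (unknown seed ratio) the normalised
  values satisfy `‖u k / u 0 - a k / a 0‖ ≤ ‖b k / a 0 - (a k / a 0) (b 0 / a 0)‖ / (1 - ‖b 0 / a 0‖)` whenever
  `‖b 0 / a 0‖ < 1` — the "ratio form" of the seed correction, which needs no lower bound on `‖u 0‖`;
* `inv_geom_remainder` — the remainder of the truncated Neumann series used by the exp-factored Newton inverse:
  `‖(1 + E)⁻¹ - ∑_{j<J} (-E)^j‖ ≤ ε^J / (1 - ε)` for `‖E‖ ≤ ε < 1`;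
* `casoratian_succ` — constancy of the Casoratian `a k * b (k+1) - a (k+1) * b k` of two solutions (the identity behind
  the Green's-function form of the a-posteriori remainder, v0.6 of the engine).
Pure algebra and norm inequalities over `ℂ`.
-/

namespace Summit.AnomalousDissipation.SoloBlind.SeedCertificate

open Complex Finset

/-- Finite Śleszyński–Pringsheim step (backward): with `‖β (k+1)‖ ≥ 2` on `M ≤ k < N` and the seed
`u (N+1) = 0`, `u N ≠ 0`, the backward solution never vanishes and its ratios stay in the closed unit disc. -/
theorem pringsheim_backward (u β : ℕ → ℂ) (M N : ℕ)
    (hrec : ∀ k, M ≤ k → k < N → u k = β (k + 1) * u (k + 1) - u (k + 2))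
    (hβ : ∀ k, M ≤ k → k < N → (2 : ℝ) ≤ ‖β (k + 1)‖)
    (hN1 : u (N + 1) = 0) (hN0 : u N ≠ 0) :
    ∀ k, M ≤ k → k ≤ N → u k ≠ 0 ∧ ‖u (k + 1)‖ ≤ ‖u k‖ := by
  suffices h : ∀ n k, k + n = N → M ≤ k → u k ≠ 0 ∧ ‖u (k + 1)‖ ≤ ‖u k‖ by
    intro k hMk hkN
    exact h (N - k) k (by omega) hMk
  intro n
  induction n with
  | zero =>
    intro k hk _
    have hkN : k = N := by omega
    subst hkN
    exact ⟨hN0, by rw [hN1, norm_zero]; exact norm_nonneg _⟩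
  | succ n ih =>
    intro k hk hMk
    have hkN : k < N := by omega
    obtain ⟨hne, hle⟩ := ih (k + 1) (by omega) (by omega)
    have hpos : 0 < ‖u (k + 1)‖ := norm_pos_iff.mpr hne
    have hk_eq := hrec k hMk hkN
    have hβk := hβ k hMk hkN
    -- ‖u k‖ ≥ ‖β‖ ‖u (k+1)‖ - ‖u (k+2)‖ ≥ 2 ‖u(k+1)‖ - ‖u(k+1)‖
    have h1 : ‖β (k + 1) * u (k + 1)‖ ≤ ‖u k‖ + ‖u (k + 2)‖ := by
      have : β (k + 1) * u (k + 1) = u k + u (k + 2) := by rw [hk_eq]; ring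
      rw [this]; exact norm_add_le _ _
    rw [norm_mul] at h1
    have h2 : ‖u (k + 1)‖ ≤ ‖u k‖ := by
      have h21 : (k + 1) + 1 = k + 2 := by ring
      rw [h21] at hle
      nlinarith
    refine ⟨?_, h2⟩
    intro h0
    rw [h0, norm_zero] at h2
    linarith

/-- Ratio form of the seed correction (identity). -/
theorem seed_ratio_identity (a0 ak b0 bk ρ : ℂ) (ha0 : a0 ≠ 0) (hden : a0 + ρ * b0 ≠ 0) :
    (ak + ρ * bk) / (a0 + ρ * b0) - ak / a0
      = ρ * (bk / a0 - (ak / a0) * (b0 / a0)) / (1 + ρ * (b0 / a0)) := by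
  have hden' : 1 + ρ * (b0 / a0) ≠ 0 := by
    intro h
    apply hden
    have : a0 + ρ * b0 = a0 * (1 + ρ * (b0 / a0)) := by field_simp
    rw [this, h, mul_zero]
  field_simp
  ring

/-- Ratio form of the seed correction (bound): `u = a + ρ b`, `‖ρ‖ ≤ 1`, `‖b0/a0‖ < 1`. -/
theorem seed_ratio_bound (a0 ak b0 bk ρ : ℂ) (ha0 : a0 ≠ 0) (hρ : ‖ρ‖ ≤ 1) (hq : ‖b0 / a0‖ < 1) :
    a0 + ρ * b0 ≠ 0 ∧
    ‖(ak + ρ * bk) / (a0 + ρ * b0) - ak / a0‖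
      ≤ ‖bk / a0 - (ak / a0) * (b0 / a0)‖ / (1 - ‖b0 / a0‖) := by
  set q : ℂ := b0 / a0 with hq_def
  have hρq : ‖ρ * q‖ ≤ ‖q‖ := by
    rw [norm_mul]
    calc ‖ρ‖ * ‖q‖ ≤ 1 * ‖q‖ := mul_le_mul_of_nonneg_right hρ (norm_nonneg _)
      _ = ‖q‖ := one_mul _
  have hlow : 1 - ‖q‖ ≤ ‖1 + ρ * q‖ := by
    have := norm_sub_norm_le (1 : ℂ) (-(ρ * q))
    rw [norm_one, norm_neg, sub_neg_eq_add] at this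
    linarith
  have hpos : 0 < 1 - ‖q‖ := by linarith
  have hden' : 1 + ρ * q ≠ 0 := by
    intro h; rw [h, norm_zero] at hlow; linarith
  have hden : a0 + ρ * b0 ≠ 0 := by
    have : a0 + ρ * b0 = a0 * (1 + ρ * q) := by rw [hq_def]; field_simp
    rw [this]; exact mul_ne_zero ha0 hden'
  refine ⟨hden, ?_⟩
  rw [seed_ratio_identity a0 ak b0 bk ρ ha0 hden, norm_div, norm_mul]
  set X : ℝ := ‖bk / a0 - (ak / a0) * (b0 / a0)‖ with hX
  have hX0 : 0 ≤ X := norm_nonneg _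
  calc ‖ρ‖ * X / ‖1 + ρ * (b0 / a0)‖
      ≤ (1 * X) / (1 - ‖q‖) := by
        apply div_le_div₀ (by positivity) (mul_le_mul_of_nonneg_right hρ hX0) hpos
        rw [← hq_def]; exact hlow
    _ = X / (1 - ‖b0 / a0‖) := by rw [one_mul, hq_def]

/-- Remainder of the truncated Neumann series for `(1 + E)⁻¹`. -/
theorem inv_geom_remainder (E : ℂ) (ε : ℝ) (J : ℕ) (hE : ‖E‖ ≤ ε) (hε : ε < 1) :
    1 + E ≠ 0 ∧ ‖(1 + E)⁻¹ - ∑ j ∈ range J, (-E) ^ j‖ ≤ ε ^ J / (1 - ε) := by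
  have hε0 : 0 ≤ ε := le_trans (norm_nonneg _) hE
  have hlow : 1 - ε ≤ ‖1 + E‖ := by
    have := norm_sub_norm_le (1 : ℂ) (-E)
    rw [norm_one, norm_neg, sub_neg_eq_add] at this
    linarith
  have hpos : 0 < 1 - ε := by linarith
  have hne : 1 + E ≠ 0 := by
    intro h; rw [h, norm_zero] at hlow; linarith
  refine ⟨hne, ?_⟩
  have hgeom : (1 + E) * ∑ j ∈ range J, (-E) ^ j = 1 - (-E) ^ J := by
    have := mul_neg_geom_sum (-E) J
    rw [sub_neg_eq_add] at this
    exact this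
  have hrepr : (1 + E)⁻¹ - ∑ j ∈ range J, (-E) ^ j = (1 + E)⁻¹ * (-E) ^ J := by
    have hS : ∑ j ∈ range J, (-E) ^ j = (1 + E)⁻¹ * (1 - (-E) ^ J) := by
      rw [← hgeom, ← mul_assoc, inv_mul_cancel₀ hne, one_mul]
    rw [hS]; ring
  rw [hrepr, norm_mul, norm_inv, norm_pow, norm_neg]
  calc ‖1 + E‖⁻¹ * ‖E‖ ^ J ≤ (1 - ε)⁻¹ * ε ^ J := by
        apply mul_le_mul
        · exact (inv_le_inv₀ (lt_of_lt_of_le hpos hlow) hpos).mpr hlow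
        · exact pow_le_pow_left₀ (norm_nonneg _) hE J
        · positivity
        · positivity
    _ = ε ^ J / (1 - ε) := by rw [div_eq_inv_mul]

/-- Constancy of the Casoratian of two solutions of the same three-term recurrence. -/
theorem casoratian_succ (a b β : ℕ → ℂ) (k : ℕ)
    (ha : a k = β (k + 1) * a (k + 1) - a (k + 2)) (hb : b k = β (k + 1) * b (k + 1) - b (k + 2)) :
    a k * b (k + 1) - a (k + 1) * b k = a (k + 1) * b (k + 2) - a (k + 2) * b (k + 1) := by
  rw [ha, hb]; ring

/-- Green's-function representation: for solutions `a`, `b`, the combination `φ j = a j * b m - b j * a m`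
solves the recurrence, vanishes at `j = m`, and equals the Casoratian at `j = m - 1` (here `m = k + 1`). -/
theorem green_combination (a b β : ℕ → ℂ) (m k : ℕ)
    (ha : a k = β (k + 1) * a (k + 1) - a (k + 2)) (hb : b k = β (k + 1) * b (k + 1) - b (k + 2)) :
    (a k * b m - b k * a m) = β (k + 1) * (a (k + 1) * b m - b (k + 1) * a m)
        - (a (k + 2) * b m - b (k + 2) * a m) ∧
    (a m * b m - b m * a m) = 0 := by
  constructor
  · rw [ha, hb]; ring
  · ring

end Summit.AnomalousDissipation.SoloBlind.SeedCertificate
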